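import Summits.BirchSwinnertonDyer.BirchSwinnertonDyer.Theorems.ErratumRoadFiveRest3NoWitnessOffLocusSlackIndex
import HarnessLib

/-!
# Route `ErratumRoadFive` (rung K2, `p ≥ 5`), crux `RamNoErratumDataAtFive` (item stmt-BirchSwinnertonDyer-19624, REST‴),
# registered stub `stub_rest3_tam` (REST⁗): the GROSS–ZAGIER-SHARP Heegner-index certificate — the per-pair certificate of
# the Tamagawa-slack road made FIELD-INDEPENDENT (cell `bsd-stepL`, owner seat `bsd-stepL-rest-p2` g3;
# `--supports stmt-BirchSwinnertonDyer-19624`; THEOREMS ONLY — no definition, no named fact, no `sorry`; Theses-FREE)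

HONEST FRAMING. Bookkeeping over multr1-p2's Gross–Zagier identity `exists_shaAn_padicVal_eq_of_heegner`
(`X11b/BDPRouteShaAn.lean`) and imc-p1's one-sided tightness; every published named fact is a HYPOTHESIS; the index
inequality and the twist's algebraic central value are per-pair CERTIFICATE binders (finite computations at ONE field),
never asserted here. BSD is proved for no pair; nothing is booked; no census word moves (T7).

WHY. The slack tool (nw1 p462332; owner's packaging p473288 §2) reads ONE odd Heegner datum with `ord_p [E(K):ℤP] ≤ t :=
ord_p ∏_ℓ c_ℓ(E)` as route p2's open input at the pair; granted BSD such a datum needs a field with `Ш(E^{d_K})[p] = 0`, and the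
census (HOME/rest/SLACK-CENSUS.md) had to SELECT fields with `p ∤ #Ш(E^{d_K})_an` (its negative control read `ord_p I = t +
½·ord_p #Ш(E^{d_K})_an > t` at the other fields). The tree's Gross–Zagier identity says more: with `q = #Ш(E)_an ∈ ℚ` and
`q_d = L(Wd,1)/Ω_{Wd}` (minimal twist model), `ord_p q + ord_p q_d + ord_p ∏c_ℓ(E) + 2·ord_p #Wd(ℚ)_tors = 2·ord_p [E(K):ℤP]`; so
the lower half of `BSD(E,p)` in its trivial form `ord_p #Ш(E)_an ≤ 0 ≤ ord_p #Ш(E)` is EXACTLY the inequality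
`2·ord_p [E(K):ℤP] ≤ ord_p q_d + ord_p ∏c_ℓ(E) + 2·ord_p #Wd(ℚ)_tors` (§1, an `iff`) at ANY odd Heegner field, from Gross–Zagier,
Kolyvagin (finiteness), GZK and modularity ONLY. Granted BSD for the twist it reads `ord_p [E(K):ℤP] ≤ t + ½·ord_p #Ш(E^{d_K})`:
the twist's `Ш` is ABSORBED, every negative-control row of the census becomes a certificate, and the field-choice constraint
of the residue disappears. The slack certificate implies this one (§3), so nothing already landed is weakened.

* §1 `gzSharpIndexAt_iff_shaAn_nonpos`, `missingLowerBoundAt_of_gzSharpIndexAt` — datum level (GZ, Kolyvagin, GZK,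
  modularity): the certificate ⟺ `#Ш(E)_an = q` with `ord_p q ≤ 0`; hence `Typed.MissingLowerBoundAt W p`.
* §2 `openInputOnTreeAt_of_gzSharpIndexAt[_of_thm331Mult]` — + Skinner 2016 Thm. C, (ram) and the control identity
  (by citation: JSW17 Thm. 3.3.1-mult) ⟹ `P2OpenInputOnTreeAt W p` (imc-p1's one-sided tightness).
* §3 `gzSharpIndexAt_of_slackIndexAt` — the Tamagawa-slack certificate implies the GZ-sharp one (`d_K` odd).
* §4 `openInputOnTreeAt_of_exists_gzSharpDatum_of_thm331Mult` — existential packaging, side conditions (`w_K = 2`,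
  `L(E^{d_K},1) ≠ 0`) discharged as in p473288 §2.
* Class level (the registered stub `stub_rest3_tam` VERBATIM, the crux BY THE ROUTE'S NAMES ⟸ published facts + JSW17
  3.3.1-mult + `hS♯`): companion file `ErratumRoadFiveRest3GZSharpIndexByName.lean` (this file is Theses-FREE).

References: [GrossZagier1986] V.§2 (p. 312); [JetchevSkinnerWan2017] §7.4.1 (eq:gz for K′), (eq:tamK), Thm. 3.3.1;
[Gross1991] (1.1), (2.2); [Skinner2016PacificMC] Thm. C; [Miller2011LMS] Def. 1.1; [Jetchev2008] (1) (the prediction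
`#Ш(E/K) = (I_K/(c·∏c_q))²`).
-/

-- the Theorems namespace of this sub repeats the summit name by design (D-0017 nested layout)
set_option linter.dupNamespace false

noncomputable section

open scoped Classical

namespace Summit.BirchSwinnertonDyer.BirchSwinnertonDyer.Theorems

open WeierstrassCurve NumberField Literature.NumberTheory.EllipticCurves
  Literature.NumberTheory.EllipticCurves.ModularForms
  Literature.NumberTheory.EllipticCurves.Rank1Residual
  Literature.NumberTheory.EllipticCurves.Rank1Residual.Typed
  Summit.BirchSwinnertonDyer.Rank1Residual Summit.BirchSwinnertonDyer.Rank1Residual.X11b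

/-! ## §1 Datum level: the GZ-sharp certificate is `ord_p #Ш(E)_an ≤ 0`, hence the lower half of `BSD(E,p)` -/

/-- **The GZ-sharp certificate ⟺ `#Ш(E)_an` is a rational of non-positive `p`-adic valuation** (datum level). Data:
`(E,p)` in X11b; `K` imaginary quadratic, Heegner for `N_E`, `p ∤ #𝓞_K^×`, `L(E^{d_K},1) ≠ 0`; `P ∈ E(K)` the Heegner
point of a datum with `p ∤ c`; `Wd = Cd • E^{(d_K)}` globally minimal; `q_d` ANY rational with `L(Wd,1)/Ω_{Wd} = q_d` (a
datum). Then `2·ord_p [E(K):ℤP] ≤ ord_p q_d + ord_p ∏c_ℓ(E) + 2·ord_p #Wd(ℚ)_tors` iff `#Ш(E)_an = q ∈ ℚ` with `ord_p q ≤ 0`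
— multr1-p2's Gross–Zagier identity `exists_shaAn_padicVal_eq_of_heegner` read both ways. Published binders `hGZ hKo hGZK
hmod`; nothing booked. [cite: GrossZagier1986, V.§2 (p. 312)] [cite: JetchevSkinnerWan2017, §7.4.1 (eq:gz for K′) and (eq:tamK), pp. 29–30] -/
theorem gzSharpIndexAt_iff_shaAn_nonpos
    (W : WeierstrassCurve ℚ) [W.IsElliptic] [W.IsGloballyMinimal] (p : ℕ) [Fact p.Prime]
    [NeZero (W.conductorNorm ℤ)] (K : Type) [Field K] [NumberField K]
    (Dt : ModularParametrizationData W (W.conductorNorm ℤ))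
    (H : HeegnerDatum (W.conductorNorm ℤ) (NumberField.discr K)) (ι : K →+* ℂ)
    (P : (W.baseChange K).toAffine.Point)
    (hGZ : gross_zagier (W.conductorNorm ℤ) W K) (hKo : kolyvagin (W.conductorNorm ℤ) W K)
    (hGZK : rank_eq_analyticRank_of_analyticRank_le_one) (hmod : hasEntireLFunction_rat)
    (hX : ClassX11b W p)
    (hK : IsImaginaryQuadratic K) (hHN : SatisfiesHeegnerHypothesis (W.conductorNorm ℤ) K)
    (hP : WeierstrassCurve.Affine.Point.map ι.toRatAlgHom P = heegnerPointComplex Dt H)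
    (hc : ¬ (p : ℤ) ∣ Dt.c) (hμ : ¬ p ∣ Units.torsionOrder K)
    (hLt : (W.quadraticTwist (NumberField.discr K : ℚ)).entireLFunction 1 ≠ 0)
    (Wd : WeierstrassCurve ℚ) [Wd.IsElliptic] [Wd.IsGloballyMinimal] (Cd : VariableChange ℚ)
    (hWd : Cd • W.quadraticTwist (NumberField.discr K : ℚ) = Wd)
    (qd : ℚ) (hqd : Wd.entireLFunction 1 / (Wd.realPeriodRat : ℂ) = (qd : ℂ)) :
    (2 * (padicValNat p (AddSubgroup.zmultiples P).index : ℤ) ≤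
        padicValRat p qd + padicValNat p W.tamagawaProduct + 2 * padicValNat p Wd.torsionOrder) ↔
      ∃ q : ℚ, shaAn W = (q : ℂ) ∧ padicValRat p q ≤ 0 := by
  obtain ⟨hr, hp2, hmult, -⟩ := hX
  have hu : padicValRat p (Cd.u : ℚ) = 0 := padicValRat_u_eq_zero_of_twist_minimal W p K hK hHN hmult Cd hWd
  obtain ⟨-, -, -, q, hq, hval⟩ := exists_shaAn_padicVal_eq_of_heegner W p (W.conductorNorm ℤ) K Dt H ι P hGZ
    hKo hGZK hmod hK hHN hP hp2 hc hμ hr hLt Wd Cd hWd hu qd hqd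
  constructor
  · intro hidx
    exact ⟨q, hq, by omega⟩
  · rintro ⟨q', hq', hle⟩
    have hqq : q' = q := by exact_mod_cast hq'.symm.trans hq
    rw [hqq] at hle
    omega

/-- **The GZ-sharp Heegner-index certificate gives the lower half of `BSD(E,p)`** (datum level). For `(E,p)` in X11b and
ONE odd-or-even Heegner datum as in `gzSharpIndexAt_iff_shaAn_nonpos`: IF
`2·ord_p [E(K):ℤP] ≤ ord_p (L(E^{d_K},1)/Ω_{E^{d_K}}) + ord_p ∏_ℓ c_ℓ(E) + 2·ord_p #E^{d_K}(ℚ)_tors` (`hidx`, the CERTIFICATE,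
with `q_d` an attested rational value of `L(Wd,1)/Ω_{Wd}`), THEN `Typed.MissingLowerBoundAt W p` — indeed `#Ш(E)_an = q`
with `ord_p q ≤ 0 ≤ ord_p #Ш(E)`. Gross–Zagier, Kolyvagin (finiteness of `Ш(E/K)`), GZK and modularity ONLY: no Skinner
2016 Thm. C, no (ram), no `p`-adic regulator, no preprint. Granted BSD for the twist, `hidx` reads
`ord_p [E(K):ℤP] ≤ ord_p ∏c_ℓ + ½·ord_p #Ш(E^{d_K})` and holds at EVERY Heegner field of a pair with `Ш(E)[p] = 0`.
CONDITIONAL on the named facts and on `hidx`/`hqd`; nothing booked. [cite: GrossZagier1986, V.§2 (p. 312)]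
[cite: JetchevSkinnerWan2017, §7.4.1 (pp. 29–31)] [cite: Miller2011LMS, Def. 1.1] -/
theorem missingLowerBoundAt_of_gzSharpIndexAt
    (W : WeierstrassCurve ℚ) [W.IsElliptic] [W.IsGloballyMinimal] (p : ℕ) [Fact p.Prime]
    [NeZero (W.conductorNorm ℤ)] (K : Type) [Field K] [NumberField K]
    (Dt : ModularParametrizationData W (W.conductorNorm ℤ))
    (H : HeegnerDatum (W.conductorNorm ℤ) (NumberField.discr K)) (ι : K →+* ℂ)
    (P : (W.baseChange K).toAffine.Point)
    (hGZ : gross_zagier (W.conductorNorm ℤ) W K) (hKo : kolyvagin (W.conductorNorm ℤ) W K)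
    (hGZK : rank_eq_analyticRank_of_analyticRank_le_one) (hmod : hasEntireLFunction_rat)
    (hX : ClassX11b W p)
    (hK : IsImaginaryQuadratic K) (hHN : SatisfiesHeegnerHypothesis (W.conductorNorm ℤ) K)
    (hP : WeierstrassCurve.Affine.Point.map ι.toRatAlgHom P = heegnerPointComplex Dt H)
    (hc : ¬ (p : ℤ) ∣ Dt.c) (hμ : ¬ p ∣ Units.torsionOrder K)
    (hLt : (W.quadraticTwist (NumberField.discr K : ℚ)).entireLFunction 1 ≠ 0)
    (Wd : WeierstrassCurve ℚ) [Wd.IsElliptic] [Wd.IsGloballyMinimal] (Cd : VariableChange ℚ)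
    (hWd : Cd • W.quadraticTwist (NumberField.discr K : ℚ) = Wd)
    (qd : ℚ) (hqd : Wd.entireLFunction 1 / (Wd.realPeriodRat : ℂ) = (qd : ℂ))
    -- THE CERTIFICATE
    (hidx : 2 * (padicValNat p (AddSubgroup.zmultiples P).index : ℤ) ≤
        padicValRat p qd + padicValNat p W.tamagawaProduct + 2 * padicValNat p Wd.torsionOrder) :
    Typed.MissingLowerBoundAt W p := by
  obtain ⟨q, hq, hle⟩ := (gzSharpIndexAt_iff_shaAn_nonpos W p K Dt H ι P hGZ hKo hGZK hmod hX hK hHN hP hc hμ hLt Wd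
    Cd hWd qd hqd).1 hidx
  exact ⟨q, hq, by omega⟩

/-! ## §2 The open input of route p2 at the pair -/

/-- **The GZ-sharp certificate gives route p2's OPEN INPUT at the pair** (every datum), given the control identity
`P2ControlOnTreeAt W p`: §1 + imc-p1's one-sided tightness `openInputOnTreeAt_of_missingLowerBoundAt_of_ram` (where Skinner
2016 Thm. C and (ram) enter). CONDITIONAL on the named facts, `hC`, `hqd`, `hidx`; nothing booked.
[cite: Castella2018, Thm. 2.3 (p. 5), (1.1) (p. 2)] [cite: JetchevSkinnerWan2017, §7.4.1 (pp. 30–31)] [cite: Skinner2016PacificMC, Thm. C (§1)] -/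
theorem openInputOnTreeAt_of_gzSharpIndexAt
    (W : WeierstrassCurve ℚ) [W.IsElliptic] [W.IsGloballyMinimal] (p : ℕ) [Fact p.Prime]
    [NeZero (W.conductorNorm ℤ)] (K : Type) [Field K] [NumberField K]
    (Dt : ModularParametrizationData W (W.conductorNorm ℤ))
    (H : HeegnerDatum (W.conductorNorm ℤ) (NumberField.discr K)) (ι : K →+* ℂ)
    (P : (W.baseChange K).toAffine.Point)
    (hGZ : ∀ (N : ℕ) [NeZero N] (W : WeierstrassCurve ℚ) (K : Type) [Field K] [NumberField K],
      gross_zagier N W K)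
    (hKo : ∀ (N : ℕ) [NeZero N] (W : WeierstrassCurve ℚ) (K : Type) [Field K] [NumberField K],
      kolyvagin N W K)
    (hSk : Skinner2016.thmC_padicValRat_bsd_rank_zero)
    (hGZK : rank_eq_analyticRank_of_analyticRank_le_one) (hmod : hasEntireLFunction_rat)
    (hC : P2ControlOnTreeAt W p)
    (hX : ClassX11b W p) (hram : Ram W p)
    (hK : IsImaginaryQuadratic K) (hHN : SatisfiesHeegnerHypothesis (W.conductorNorm ℤ) K)
    (hP : WeierstrassCurve.Affine.Point.map ι.toRatAlgHom P = heegnerPointComplex Dt H)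
    (hc : ¬ (p : ℤ) ∣ Dt.c) (hμ : ¬ p ∣ Units.torsionOrder K)
    (hLt : (W.quadraticTwist (NumberField.discr K : ℚ)).entireLFunction 1 ≠ 0)
    (Wd : WeierstrassCurve ℚ) [Wd.IsElliptic] [Wd.IsGloballyMinimal] (Cd : VariableChange ℚ)
    (hWd : Cd • W.quadraticTwist (NumberField.discr K : ℚ) = Wd)
    (qd : ℚ) (hqd : Wd.entireLFunction 1 / (Wd.realPeriodRat : ℂ) = (qd : ℂ))
    (hidx : 2 * (padicValNat p (AddSubgroup.zmultiples P).index : ℤ) ≤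
        padicValRat p qd + padicValNat p W.tamagawaProduct + 2 * padicValNat p Wd.torsionOrder) :
    P2OpenInputOnTreeAt W p :=
  openInputOnTreeAt_of_missingLowerBoundAt_of_ram W p hGZ hKo hSk hGZK hmod hC hram
    (missingLowerBoundAt_of_gzSharpIndexAt W p K Dt H ι P (hGZ _ W K) (hKo _ W K) hGZK hmod hX hK hHN hP hc hμ hLt Wd Cd
      hWd qd hqd hidx)

/-- **The same with the control identity BY CITATION** (JSW17 Thm. 3.3.1-mult, `p2ControlOnTreeAt_of_thm331Mult`).
CONDITIONAL on the named facts and on the certificate; nothing booked.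
[cite: JetchevSkinnerWan2017, Thm. 3.3.1 with §3.5 (3.5.c) (arXiv:1512.06894 pp. 11, 15)] [cite: Skinner2016PacificMC, Thm. C (§1)] -/
theorem openInputOnTreeAt_of_gzSharpIndexAt_of_thm331Mult
    (W : WeierstrassCurve ℚ) [W.IsElliptic] [W.IsGloballyMinimal] (p : ℕ) [Fact p.Prime]
    [NeZero (W.conductorNorm ℤ)] (K : Type) [Field K] [NumberField K]
    (Dt : ModularParametrizationData W (W.conductorNorm ℤ))
    (H : HeegnerDatum (W.conductorNorm ℤ) (NumberField.discr K)) (ι : K →+* ℂ)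
    (P : (W.baseChange K).toAffine.Point)
    (hGZ : ∀ (N : ℕ) [NeZero N] (W : WeierstrassCurve ℚ) (K : Type) [Field K] [NumberField K],
      gross_zagier N W K)
    (hKo : ∀ (N : ℕ) [NeZero N] (W : WeierstrassCurve ℚ) (K : Type) [Field K] [NumberField K],
      kolyvagin N W K)
    (hSk : Skinner2016.thmC_padicValRat_bsd_rank_zero)
    (hGZK : rank_eq_analyticRank_of_analyticRank_le_one) (hmod : hasEntireLFunction_rat)
    (h331 : JetchevSkinnerWan2017.thm331_anticyclotomicControl_mult)
    (hX : ClassX11b W p) (hram : Ram W p)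
    (hK : IsImaginaryQuadratic K) (hHN : SatisfiesHeegnerHypothesis (W.conductorNorm ℤ) K)
    (hP : WeierstrassCurve.Affine.Point.map ι.toRatAlgHom P = heegnerPointComplex Dt H)
    (hc : ¬ (p : ℤ) ∣ Dt.c) (hμ : ¬ p ∣ Units.torsionOrder K)
    (hLt : (W.quadraticTwist (NumberField.discr K : ℚ)).entireLFunction 1 ≠ 0)
    (Wd : WeierstrassCurve ℚ) [Wd.IsElliptic] [Wd.IsGloballyMinimal] (Cd : VariableChange ℚ)
    (hWd : Cd • W.quadraticTwist (NumberField.discr K : ℚ) = Wd)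
    (qd : ℚ) (hqd : Wd.entireLFunction 1 / (Wd.realPeriodRat : ℂ) = (qd : ℂ))
    (hidx : 2 * (padicValNat p (AddSubgroup.zmultiples P).index : ℤ) ≤
        padicValRat p qd + padicValNat p W.tamagawaProduct + 2 * padicValNat p Wd.torsionOrder) :
    P2OpenInputOnTreeAt W p :=
  openInputOnTreeAt_of_gzSharpIndexAt W p K Dt H ι P hGZ hKo hSk hGZK hmod (p2ControlOnTreeAt_of_thm331Mult W p h331 hKo)
    hX hram hK hHN hP hc hμ hLt Wd Cd hWd qd hqd hidx

/-! ## §3 The Tamagawa-slack certificate implies the GZ-sharp certificate -/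

/-- **Slack ⟹ GZ-sharp** (`d_K` odd). At a datum of an X11b ∧ (ram) pair with `d_K` odd, Skinner 2016 Thm. C for the
minimal twist model (multiplicative at `p`, `E^{d_K}[p]` irreducible, the (ram) witness transported — all `ℓ ∣ N` split)
gives `ord_p q_d = ord_p #Ш(E^{d_K}) + ord_p ∏c_ℓ(E^{d_K}) − 2·ord_p #E^{d_K}(ℚ)_tors`, and the transport
`ord_p ∏c_ℓ(E^{d_K}) = ord_p ∏c_ℓ(E)` (eisenstein-p2's `X2.padicValNat_tamagawaProduct_twist_of_heegner_of_odd`); so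
`ord_p [E(K):ℤP] ≤ ord_p ∏c_ℓ(E)` implies the GZ-sharp inequality (with slack `ord_p #Ш(E^{d_K}) ≥ 0`). Hence every
landed slack certificate is a GZ-sharp certificate; nothing is weakened. CONDITIONAL on `hSk hGZK hmod`; nothing booked.
[cite: Skinner2016PacificMC, Thm. C (§1) and footnote 1] [cite: JetchevSkinnerWan2017, (eq:tamK) (p. 30)] -/
theorem gzSharpIndexAt_of_slackIndexAt
    (W : WeierstrassCurve ℚ) [W.IsElliptic] [W.IsGloballyMinimal] (p : ℕ) [Fact p.Prime]
    (K : Type) [Field K] [NumberField K] (P : (W.baseChange K).toAffine.Point)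
    (hSk : Skinner2016.thmC_padicValRat_bsd_rank_zero)
    (hGZK : rank_eq_analyticRank_of_analyticRank_le_one) (hmod : hasEntireLFunction_rat)
    (hX : ClassX11b W p) (hram : Ram W p)
    (hK : IsImaginaryQuadratic K) (hodd : Odd (NumberField.discr K))
    (hHN : SatisfiesHeegnerHypothesis (W.conductorNorm ℤ) K)
    (hLt : (W.quadraticTwist (NumberField.discr K : ℚ)).entireLFunction 1 ≠ 0)
    (Wd : WeierstrassCurve ℚ) [Wd.IsElliptic] [Wd.IsGloballyMinimal] (Cd : VariableChange ℚ)
    (hWd : Cd • W.quadraticTwist (NumberField.discr K : ℚ) = Wd)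
    (qd : ℚ) (hqd : Wd.entireLFunction 1 / (Wd.realPeriodRat : ℂ) = (qd : ℂ))
    (hslack : padicValNat p (AddSubgroup.zmultiples P).index ≤ padicValNat p W.tamagawaProduct) :
    2 * (padicValNat p (AddSubgroup.zmultiples P).index : ℤ) ≤
      padicValRat p qd + padicValNat p W.tamagawaProduct + 2 * padicValNat p Wd.torsionOrder := by
  have hp : p.Prime := Fact.out
  obtain ⟨-, hp2, hmult, hirr⟩ := hX
  have hp3 : 3 ≤ p := by have := hp.two_le; omega
  -- transports to the minimal twist model (all `ℓ ∣ N` split in `K`)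
  have hmultd : Wd.HasMultiplicativeReductionAtPrime p :=
    hasMultiplicativeReductionAtPrime_twist_of_heegner' W p K hK hHN hmult Cd hWd
  have hirrd : Wd.HasIrreducibleModPGaloisRep p := hasIrreducibleModPGaloisRep_twist_model W p K hK.1 hirr Cd hWd
  have hramd : Ram Wd p := ram_twist_of_heegner W p K hK hHN hram Cd hWd
  have hpN : p ∣ W.conductorNorm ℤ :=
    (W.dvd_conductorNorm_iff_not_hasGoodReductionAtPrime p).mpr
      (WeierstrassCurve.HasMultiplicativeReduction.not_hasGoodReduction (R := ℤ_[p]) hmult)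
  have hpd : ¬ (p : ℤ) ∣ NumberField.discr K := Literature.SatisfiesHeegnerHypothesis.not_dvd_discr hK.1 hHN hp hpN
  have htam : padicValNat p Wd.tamagawaProduct = padicValNat p W.tamagawaProduct :=
    X2.padicValNat_tamagawaProduct_twist_of_heegner_of_odd W p hp2 K hK hodd hpd hHN Cd hWd
  -- the twist has analytic rank `0` and finite `Ш`; Skinner's Thm. C (exact `p`-part of its BSD formula)
  have hD0 : (NumberField.discr K : ℚ) ≠ 0 := by exact_mod_cast NumberField.discr_ne_zero K
  haveI hEt : (W.quadraticTwist (NumberField.discr K : ℚ)).IsElliptic := W.isElliptic_quadraticTwist hD0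
  have hLt' : (W.quadraticTwist (NumberField.discr K : ℚ)).entireLFunction = Wd.entireLFunction := by
    rw [← hWd, entireLFunction_smul]
  have hLd1 : Wd.entireLFunction 1 ≠ 0 := by rw [← hLt']; exact hLt
  have hrd : Wd.analyticRank = 0 := (Wd.analyticRank_eq_zero_iff_holds (hmod Wd)).2 hLd1
  have hfinSd : Finite Wd.sha := (hGZK Wd (by omega)).2
  obtain ⟨qd', hqd', hvqd'⟩ := hSk Wd p hp3 (Or.inr hmultd) hirrd hramd hLd1 hfinSd
  have hqq : qd' = qd := by exact_mod_cast hqd'.symm.trans hqd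
  rw [hqq] at hvqd'
  have e1 : (padicValNat p (AddSubgroup.zmultiples P).index : ℤ) ≤ padicValNat p W.tamagawaProduct := by
    exact_mod_cast hslack
  omega

/-! ## §4 Existential packaging at a pair (side conditions discharged) -/

/-- **At a pair: ONE GZ-sharp odd Heegner datum gives the open input.** For `(E, p)` in X11b with a (ram) witness: an
imaginary quadratic `K` with `d_K` odd, `d_K < −4`, Heegner for `N_E`; a parametrisation datum `Dt` with `p ∤ c`, a Heegner
datum `H`, an embedding `ι`, the Heegner point `P ∈ E(K)`, NON-torsion; a globally minimal model `Wd = Cd • E^{(d_K)}` and a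
rational `q_d = L(Wd,1)/Ω_{Wd}`; and the certificate `2·ord_p [E(K):ℤP] ≤ ord_p q_d + ord_p ∏c_ℓ(E) + 2·ord_p #Wd(ℚ)_tors` ⟹
`P2OpenInputOnTreeAt W p`. Discharged inside (as in p473288 §2): `w_K = 2`, `L(E^{d_K},1) ≠ 0` (Gross 1991 (1.1): the Heegner
point is non-torsion). CONDITIONAL on the named facts; the datum is a per-pair CERTIFICATE; nothing booked.
[cite: Gross1991, (1.1) and Thm. 1.3] [cite: GrossZagier1986, V.§2 (p. 312)] [cite: JetchevSkinnerWan2017, Thm. 3.3.1, §7.4.1]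
[cite: Skinner2016PacificMC, Thm. C (§1)] [cite: Cox2013, §7.A (w_K = 2 for d_K < −4)] -/
theorem openInputOnTreeAt_of_exists_gzSharpDatum_of_thm331Mult
    (W : WeierstrassCurve ℚ) [W.IsElliptic] [W.IsGloballyMinimal] (p : ℕ) [Fact p.Prime]
    [NeZero (W.conductorNorm ℤ)]
    (hGZ : ∀ (N : ℕ) [NeZero N] (W : WeierstrassCurve ℚ) (K : Type) [Field K] [NumberField K],
      gross_zagier N W K)
    (hKo : ∀ (N : ℕ) [NeZero N] (W : WeierstrassCurve ℚ) (K : Type) [Field K] [NumberField K],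
      kolyvagin N W K)
    (hSk : Skinner2016.thmC_padicValRat_bsd_rank_zero)
    (hGZK : rank_eq_analyticRank_of_analyticRank_le_one) (hmod : hasEntireLFunction_rat)
    (h331 : JetchevSkinnerWan2017.thm331_anticyclotomicControl_mult)
    (hX : ClassX11b W p) (hram : Ram W p)
    (hS : ∃ (K : Type) (_ : Field K) (_ : NumberField K)
      (Dt : ModularParametrizationData W (W.conductorNorm ℤ))
      (H : HeegnerDatum (W.conductorNorm ℤ) (NumberField.discr K)) (ι : K →+* ℂ)
      (P : (W.baseChange K).toAffine.Point)
      (Wd : WeierstrassCurve ℚ) (_ : Wd.IsElliptic) (_ : Wd.IsGloballyMinimal) (Cd : VariableChange ℚ) (qd : ℚ),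
      IsImaginaryQuadratic K ∧ Odd (NumberField.discr K) ∧ NumberField.discr K < -4 ∧
        SatisfiesHeegnerHypothesis (W.conductorNorm ℤ) K ∧
        WeierstrassCurve.Affine.Point.map ι.toRatAlgHom P = heegnerPointComplex Dt H ∧
        ¬ (p : ℤ) ∣ Dt.c ∧ ¬ IsOfFinAddOrder P ∧
        Cd • W.quadraticTwist (NumberField.discr K : ℚ) = Wd ∧
        Wd.entireLFunction 1 / (Wd.realPeriodRat : ℂ) = (qd : ℂ) ∧
        2 * (padicValNat p (AddSubgroup.zmultiples P).index : ℤ) ≤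
          padicValRat p qd + padicValNat p W.tamagawaProduct + 2 * padicValNat p Wd.torsionOrder) :
    P2OpenInputOnTreeAt W p := by
  obtain ⟨K, _, _, Dt, H, ι, P, Wd, _, _, Cd, qd, hK, hodd, hlt, hHN, hP, hc, hnt, hWd, hqd, hidx⟩ := hS
  have hp : p.Prime := Fact.out
  -- `w_K = 2` since `d_K < −4`, so `p ∤ #𝓞_K^×` (`p ≠ 2` is part of `ClassX11b`)
  have hμ : ¬ p ∣ NumberField.Units.torsionOrder K := by
    rw [Literature.NumberTheory.DiophantineGeometry.torsionOrder_eq_two_of_discr_lt hK.1 hlt]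
    intro h2
    exact hX.2.1 ((Nat.prime_dvd_prime_iff_eq hp Nat.prime_two).mp h2)
  -- `L(E^{d_K},1) ≠ 0`: the Heegner point is non-torsion and `L′(E/K,1) = L′(E,1)·L(E^{d_K},1)`
  have hLt : (W.quadraticTwist (NumberField.discr K : ℚ)).entireLFunction 1 ≠ 0 := by
    intro h0
    have hLK : LDerivEK W K ≠ 0 :=
      (lDerivEK_ne_zero_iff_not_isOfFinAddOrder W (W.conductorNorm ℤ) K (hGZ _ W K) hK hHN ⟨Dt, H, ι, hP⟩).mpr hnt
    rw [KrizLi2019.lDerivEK_eq_deriv_mul W K hmod (entireLFunction_one_eq_zero_of_analyticRank_eq_one hX.1), h0,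
      mul_zero] at hLK
    exact hLK rfl
  exact openInputOnTreeAt_of_gzSharpIndexAt_of_thm331Mult W p K Dt H ι P hGZ hKo hSk hGZK hmod h331 hX hram hK hHN hP hc
    hμ hLt Wd Cd hWd qd hqd hidx

end Summit.BirchSwinnertonDyer.BirchSwinnertonDyer.Theorems

end
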